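import Mathlib

/-!
# PercRepro — the `(7,3)` cell: THE STAR TABLE of Theorem P₁(7,3) (p3, gen 15)

mine-2's `MINE2-RLS.md` §27.1–27.3: the witnesses of nullity two of the reduced world are grouped by the point-class `P`
of the dual containing `W ∖ X`; the contribution of a class,
`Δ_P = Σ_{z_P ≥ 1, z_ℓ} C(c_P, z_P)·C(ℓ₀, z_ℓ)·[1/D_star(ℓ', n, x) − g(x)·[x ≤ 3]]` (`z = z_P + z_ℓ ≥ 2`, `x = 7 − z`,
`ℓ' = t_P + (c_P − z_P) + (ℓ₀ − z_ℓ)`), depends only on its STAR DATUM: `t_P ∈ {0,1}` (a point of `T` in the class),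
`c_P ≥ 1` (its `W`-points), `ℓ₀ ≤ 3` loops, and the sizes `n_i = k_i + L_i` of the classes of the contraction, i.e. the
lines through `P` with their `k_i` points of `T` and `L_i` points of `W` off `P`. Lemma 27.2 (the rank-`2` contraction):
`D_star = 36·C(ℓ', ν) + 6·Σ_i Σ_{j ≥ 2} C(n_i, j)·C(ℓ', ν − j + 1) + Σ_{j ≥ 3} cyc_j·C(ℓ', ν − j + 2)`, `ν = x − 2`, where
`cyc_j` counts the `j`-subsets of the non-loops meeting `≥ 3` classes or exactly `2` classes with `≥ 2` points in each.

REALISABILITY of an `n`-multiset (the flat condition `c_P + L_i + ℓ₀ ≤ 5` on every line, `Σ k_i = 3 − t_P` over at least two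
lines with `k_i ≤ 2 − t_P`): with `mx = 5 − c_P − ℓ₀` the excess `(n_i − mx)⁺` must be carried by points of `T`:
`(n_i − mx)⁺ ≤ 2 − t_P`, `Σ (n_i − mx)⁺ ≤ 3 − t_P ≤ Σ min(n_i, 2 − t_P)`, `Σ n_i = 10 − t_P − c_P − ℓ₀`, at least two lines.
The guarded enumeration is EXACTLY the projection of the 489 `(k_i, L_i)`-data of the prose to `n`-multisets
(192 cells, `mining/p3/g15/startable_twin.py`, 0 mismatches both ways).

INTEGER FORM: every `D_star` of the table and every `C(x+3,3)` divides `Ls = 4 485 272 418 460 562 929 200`;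
`deltaStarN = Ls·Δ_P` by structural recursions; THEOREM `starTable`: every cell has `deltaStarN ≥ 0`, and `≥ 180 876 054 219 689 929 716
= (3827/94900)·Ls` when `ℓ₀ = 3` — §27.3's star minima (`1/72`, `1/72`, `11/266`, `3827/94900`) in the kernel.
(`P3-C025-seven-three-plan.md` §6, M6 — the star half.)
-/

namespace PercRepro

namespace SevenThree

namespace StarTable

/-- The common denominator of the star table. -/
def Ls : ℤ := 4485272418460562929200

/-- `Σ_{i ≤ n} f i`, structurally. -/
def sumTo : ℕ → (ℕ → ℤ) → ℤ
  | 0, f => f 0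
  | n + 1, f => sumTo n f + f (n + 1)

/-- `Σ_{i ≤ n} f i` in `ℕ`, structurally. -/
def sumToN : ℕ → (ℕ → ℕ) → ℕ
  | 0, f => f 0
  | n + 1, f => sumToN n f + f (n + 1)

/-- `C(lp, t)` for `t = base − j`, or `0` when `j > base`. -/
def chooseSub (lp base j : ℕ) : ℤ := if j ≤ base then (Nat.choose lp (base - j) : ℤ) else 0

/-- The cyclic `j`-subsets of the classes `cs` (sizes), weighted: a choice of `v ≤ c` points in each class is cyclic when it
meets at least three classes, or exactly two classes with at least two points in each. -/
def cycRec : List ℕ → ℕ → ℕ → Bool → ℕ → ℕ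
  | [], rem, hits, min2, mult => if rem = 0 ∧ (3 ≤ hits ∨ (hits = 2 ∧ min2 = true)) then mult else 0
  | c :: cs, rem, hits, min2, mult =>
      sumToN (min c rem) (fun v =>
        cycRec cs (rem - v) (hits + (if v = 0 then 0 else 1)) (min2 && (v = 0 || 2 ≤ v)) (mult * Nat.choose c v))

/-- `cyc_j` of the class list. -/
def cyc (cs : List ℕ) (j : ℕ) : ℕ := cycRec cs j 0 true 1

/-- The within-class part `Σ_i Σ_{j ≥ 2} C(n_i, j)·C(lp, ν + 1 − j)` of Lemma 27.2. -/
def withinSum (lp nu : ℕ) : List ℕ → ℤ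
  | [] => 0
  | c :: cs => sumTo c (fun j => if 2 ≤ j then (Nat.choose c j : ℤ) * chooseSub lp (nu + 1) j else 0) + withinSum lp nu cs

/-- Lemma 27.2: `D_star(lp, cs, x)` with `ν = x − 2`. -/
def DstarN (lp : ℕ) (cs : List ℕ) (x : ℕ) : ℤ :=
  36 * (Nat.choose lp (x - 2) : ℤ) + 6 * withinSum lp (x - 2) cs +
    sumTo cs.sum (fun j => if 3 ≤ j then (cyc cs j : ℤ) * chooseSub lp (x - 2 + 2) j else 0)

/-- The `Φ`-term `Ls / C(x+3, 3)` for `x ≤ 3`, else `0`. -/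
def phiTermN (x : ℕ) : ℤ := if x ≤ 3 then Ls / (Nat.choose (x + 3) 3 : ℤ) else 0

/-- The scaled bracket of the witness class `(z_P, z_ℓ)`: `0` unless `z = z_P + z_ℓ ≥ 2`. -/
def bracketN (tP cP l0 : ℕ) (cs : List ℕ) (zP zl : ℕ) : ℤ :=
  if zP + zl < 2 then 0
  else Ls / DstarN (tP + (cP - zP) + (l0 - zl)) cs (7 - (zP + zl)) - phiTermN (7 - (zP + zl))

/-- `Ls · Δ_P` of the star datum `(t_P, c_P, ℓ₀, cs)`: the sum over `1 ≤ z_P ≤ c_P`, `z_ℓ ≤ ℓ₀`. -/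
def deltaStarN (tP cP l0 : ℕ) (cs : List ℕ) : ℤ :=
  sumTo cP (fun zP => if zP = 0 then 0 else
    sumTo l0 (fun zl => (Nat.choose cP zP : ℤ) * (Nat.choose l0 zl : ℤ) * bracketN tP cP l0 cs zP zl))

/-- Divisibility of `Ls` by every denominator of the datum (so the integer form is exact). -/
def divOK (tP cP l0 : ℕ) (cs : List ℕ) : Bool :=
  (List.range (cP + 1)).all (fun zP => zP = 0 ||
    (List.range (l0 + 1)).all (fun zl => zP + zl < 2 ||
      decide (0 < DstarN (tP + (cP - zP) + (l0 - zl)) cs (7 - (zP + zl)) ∧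
        DstarN (tP + (cP - zP) + (l0 - zl)) cs (7 - (zP + zl)) ∣ Ls)))

/-- The lower bound: `0` for `ℓ₀ ≤ 2`, `(3827/94900)·Ls` at `ℓ₀ = 3`. -/
def starBound (l0 : ℕ) : ℤ := if l0 ≤ 2 then 0 else 180876054219689929716

/-- The realisability guard on a sorted `n`-vector. -/
def realisable (tP cP l0 : ℕ) (cs : List ℕ) : Bool :=
  let mx := 5 - cP - l0
  decide (1 ≤ cP ∧ cP + l0 ≤ 5 ∧ cs.sum = 10 - tP - cP - l0 ∧ 2 ≤ (cs.filter (fun n => 1 ≤ n)).length ∧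
    (cs.map (fun n => n - mx)).all (fun e => e ≤ 2 - tP) ∧
    (cs.map (fun n => n - mx)).sum ≤ 3 - tP ∧ 3 - tP ≤ (cs.map (fun n => min n (2 - tP))).sum)

/-- All sorted vectors of length `depth` with entries `≤ mx` and sum `≤ rem` (extending the reversed prefix `acc`)
satisfy the test `p`. -/
def allSortedSum (p : List ℕ → Bool) : ℕ → ℕ → ℕ → List ℕ → Bool
  | 0, _, _, acc => p acc.reverse
  | d + 1, mx, rem, acc => (List.range (min mx rem + 1)).all (fun n => allSortedSum p d n (rem - n) (n :: acc))

/-- The cell test of the table: a realisable datum has exact divisions and `deltaStarN ≥ starBound ℓ₀`. -/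
def cellOK (tP cP l0 : ℕ) (cs : List ℕ) : Bool :=
  !realisable tP cP l0 cs || (divOK tP cP l0 cs && decide (starBound l0 ≤ deltaStarN tP cP l0 cs))

/-- The table at fixed `(t_P, ℓ₀)`: every `c_P < 6` and every sorted `n`-vector of length `9` with sum
`≤ 10 − t_P − c_P − ℓ₀` (the guard then selects the exact sum). -/
def starCheck (tP l0 : ℕ) : Bool :=
  (List.range 6).all (fun cP => allSortedSum (cellOK tP cP l0) 9 9 (10 - tP - cP - l0) [])

/-- `starCheck 0 0` (by `decide +kernel`). -/
theorem starCheck_0_0 : starCheck 0 0 = true := by decide +kernel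
/-- `starCheck 0 1`. -/
theorem starCheck_0_1 : starCheck 0 1 = true := by decide +kernel
/-- `starCheck 0 2`. -/
theorem starCheck_0_2 : starCheck 0 2 = true := by decide +kernel
/-- `starCheck 0 3`. -/
theorem starCheck_0_3 : starCheck 0 3 = true := by decide +kernel
/-- `starCheck 1 0`. -/
theorem starCheck_1_0 : starCheck 1 0 = true := by decide +kernel
/-- `starCheck 1 1`. -/
theorem starCheck_1_1 : starCheck 1 1 = true := by decide +kernel
/-- `starCheck 1 2`. -/
theorem starCheck_1_2 : starCheck 1 2 = true := by decide +kernel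
/-- `starCheck 1 3`. -/
theorem starCheck_1_3 : starCheck 1 3 = true := by decide +kernel

/-- **THE STAR TABLE**: `starCheck t_P ℓ₀ = true` for `t_P ≤ 1`, `ℓ₀ ≤ 3`. -/
theorem starTable : ∀ tP < 2, ∀ l0 < 4, starCheck tP l0 = true := by
  intro tP htP l0 hl0
  interval_cases tP <;> interval_cases l0
  · exact starCheck_0_0
  · exact starCheck_0_1
  · exact starCheck_0_2
  · exact starCheck_0_3
  · exact starCheck_1_0
  · exact starCheck_1_1
  · exact starCheck_1_2
  · exact starCheck_1_3

end StarTable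

end SevenThree

end PercRepro
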